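/-
Copyright (c) 2026 the pub-hodgecm-mathlib formalisation cell (harness21).  Prover seat hodgecm-mathlib-F0P3a-p01 (g18): road «S3-ram», (Cnt2′) ROUTE B, chair F0P3a-p07 (g15)
RULING (16)(c) ∕ (17) — the LATTICE → RESIDUAL-CONIC junction for the ROOT's value-keyed children (generic `γ`), 2026-09-02.
-/
import Literature.NumberTheory.Rogawski1990.DepthZeroKappaTransferTypeOneRamifiedRootLineCountsLattice   -- ★ (F0P2 lineage, A-p16 (g32)): §3 tools `exists_integer_pairing_mulVec`, `inv_pow_mul_pairing_sub_one_eq`, `v_lt_one_iff_exists_residue_eq_zero`, `exists_unit_class_iff_exists_residue`; brings ★ G3⁗ `ncard_neighborSet_root_pred_eq_natCard`, ★ `quadraticChar_mul_mul_self_mul`, ★ `residue_eq_zero_iff_v_lt_one`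
import HarnessLib

/-!
# Root children keyed by the depth-`d` line value ↦ points of the residual conic (ramified, `Φ₃ = J₀`-model; any `γ` with `γ − 1 ∈ ϖ^d·M₃(𝒪)`)

For `γ ∈ U(σ, J₀)` with integral leading matrix `Y₀ = (ϖ^d)⁻¹(γ − 1)` and residual matrix `Ȳ = Y₀ mod ϖ`, the children `c = κ·N₁` (`κ ∈ K₀ = U(J₀) ∩ GL₃(𝒪)`) of the
root `L₀ = 𝒪³` are in bijection with the `q + 1` points `p` of the residual conic `2b + a² = 0` (★ G3⁗'s chart `x_∞ = e₂`, `x_{(a,b)} = (1, a, b)`), and the depth-`d`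
value `(ϖ^d)⁻¹·Φ₃(κe₀, (γ − 1)κe₀)` of the child has residue class that of `Q_Ȳ(x_p) := ᵗx_p (J₀Ȳ) x_p` up to non-zero squares.  Hence, in EXACTLY the value-only child-set
currency of ★ `rootSlices_hyperbolic_of_lineCounts` ∕ ★ `rootRegionPackage_hyperbolic_of_lineCounts` (their `hνE hνP hνM` binders, depth `d₀ ↦ d`) and EXACTLY the
normalised-parameter currency of ★ G3⁗ ∕ the finite census heads (`Nat.card {p ∕∕ …Q_Ȳ(x_p)…}`):

* §1 residual bookkeeping: a unit `ε` with `|z² − ε| = 1` for all integral `z` has `χ(ε̄) = −1`; twisting the class key by such an `ε` flips `χ = 1` to `χ = −1`.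
* §2 `ncard_rootChildren_null_eq_natCard`: `#{E-children} = #{p : Q_Ȳ(x_p) = 0}`;
  `ncard_rootChildren_class_eq_natCard`: `#{children of class s} = #{p : χ(c̄₀⁻¹·Q_Ȳ(x_p)) = 1}` (`s = c₀` a unit);
  `ncard_rootChildren_negClass_eq_natCard` ∕ `ncard_rootChildren_negClass_mul_eq_natCard`: the engine's `P`-class `−c₁` and `M`-class `−(c₁ε)` as `χ((−c̄₀)⁻¹·Q) = 1` ∕ `= −1`.

No tree, no self-duality, no depth hypotheses are needed: this is pure bookkeeping over ★ G3⁗ (the bijection `p ↦ N_{x_p}` and the frame independence of the residual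
value class), generic in `γ` and `d`; the hyperbolic (`γ = ι(B₀,1)`, `Ȳ = ι(Ȳ_W, 0)`) and anisotropic literals are instances.

References: [cite: BruhatTits1972, §10] (the building ∕ lattice tree), [cite: Kottwitz1986, §3] (orbital integrals as lattice counts keyed by `γ − 1`),
[cite: Rogawski1990, §4.9 Prop. 4.9.1 (b) p. 55] (the type-(2) ramified junction count), [cite: IrelandRosen1990, Ch. 8 §1] (quadratic character bookkeeping).
-/

set_option autoImplicit false

open scoped Valued WithZero Matrix MatrixGroups
open Finset
open Literature.NumberTheory.Automorphic Literature.NumberTheory.Automorphic.HermitianLattice Literature.NumberTheory.Automorphic.UnitaryLatticeTree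

namespace Literature.NumberTheory.Rogawski1990.TypeOneRamifiedJunction

variable {K : Type*} [Field K] [Valued K ℤᵐ⁰] {σ : K →+* K} {ϖ : K}

/-! ## §1 Residual bookkeeping: non-square unit keys -/

/-- A unit `ε` with `|z² − ε| = 1` for every integral `z` (the engine's `hε`) is residually a NON-SQUARE: `χ(ε̄) = −1`. [cite: IrelandRosen1990, Ch. 8 §1] -/
theorem quadraticChar_residue_eq_neg_one_of_forall [Fintype 𝓀[K]] [DecidableEq 𝓀[K]] {ε : K}
    (hε : ∀ z : K, Valued.v z ≤ 1 → Valued.v (z ^ 2 - ε) = 1) (ε₀ : 𝒪[K]) (hε₀ : (ε₀ : K) = ε) :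
    quadraticChar 𝓀[K] (IsLocalRing.residue 𝒪[K] ε₀) = -1 := by
  rw [quadraticChar_neg_one_iff_not_isSquare]
  rintro ⟨r, hr⟩
  obtain ⟨z, rfl⟩ := IsLocalRing.residue_surjective r
  have h0 : IsLocalRing.residue 𝒪[K] (z ^ 2 - ε₀) = 0 := by
    rw [map_sub, map_pow, hr, sub_eq_zero, pow_two]
  rw [residue_eq_zero_iff_v_lt_one] at h0
  have h1 := hε (z : K) (z.2)
  have hco : (((z ^ 2 - ε₀ : 𝒪[K]) : 𝒪[K]) : K) = (z : K) ^ 2 - ε := by rw [← hε₀]; push_cast; ring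
  rw [hco, h1] at h0
  exact lt_irrefl _ h0

/-- Twisting the class key by a residual non-square flips the class: `#{x : χ((c·e)⁻¹·Q x) = 1} = #{x : χ(c⁻¹·Q x) = −1}` for `χ(e) = −1`. [cite: IrelandRosen1990, Ch. 8 §1] -/
theorem natCard_quadraticChar_inv_mul_eq_one_eq_of_eq_neg_one {k : Type*} [Field k] [Fintype k] [DecidableEq k] {X : Type*} (Q : X → k)
    (c : k) {e : k} (he : quadraticChar k e = -1) :
    Nat.card {x : X // quadraticChar k ((c * e)⁻¹ * Q x) = 1} = Nat.card {x : X // quadraticChar k (c⁻¹ * Q x) = -1} := by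
  have he0 : e ≠ 0 := fun h0 => by rw [h0, MulChar.map_zero] at he; norm_num at he
  have key : ∀ x : X, quadraticChar k ((c * e)⁻¹ * Q x) = 1 ↔ quadraticChar k (c⁻¹ * Q x) = -1 := fun x => by
    rw [show (c * e)⁻¹ * Q x = e⁻¹ ^ 2 * (e * (c⁻¹ * Q x)) by field_simp, map_mul, quadraticChar_sq_one' (inv_ne_zero he0), one_mul,
      map_mul, he, neg_one_mul, neg_eq_iff_eq_neg]
  exact Nat.card_congr (Equiv.subtypeEquivRight key)

/-! ## §2 The root's value-keyed children ↦ points of the residual conic -/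

set_option maxHeartbeats 800000 in
-- budget only: the child set-builder (★ `rootSlices_hyperbolic_of_lineCounts`'s `hνE` text) elaborates once per token.
/-- **THE `E`-CHILDREN OF THE ROOT = THE NULL POINTS OF THE RESIDUAL CONIC.**  For `γ ∈ U(σ, J₀)` with `(ϖ^d)⁻¹(γ − 1) = Y₀ ∈ M₃(𝒪)`: the number of children
`c = κ·N₁` (`κ ∈ K₀`) of the root at distance `1` whose depth-`d` line value `(ϖ^d)⁻¹·Φ₃(κe₀, (γ−1)κe₀)` is a NON-UNIT (★ `rootSlices_hyperbolic_of_lineCounts`'s `hνE`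
set VERBATIM, `d₀ ↦ d`) equals `#{p ∈ {∞} ⊔ {(a,b) : 2b + a² = 0} : ᵗx_p (J₀Ȳ) x_p = 0}` (★ G3⁗'s parameter currency VERBATIM).  Chain: distance clause ⟺ adjacency
(`dist r₀ r₀ = 0`); `c = κ·⟨N₁,2⟩ ⟺ c.1 = κ·N₁`; value: ★ `pairing_antidiagonal`, ★ `inv_pow_mul_pairing_sub_one_eq`, integrality ★ `exists_integer_pairing_mulVec`, ★
`v_lt_one_iff_exists_residue_eq_zero`; then ★ G3⁗ `ncard_neighborSet_root_pred_eq_natCard` with `P = (· = 0)`. [cite: BruhatTits1972, §10] [cite: Kottwitz1986, §3]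
[cite: Rogawski1990, §4.9 Prop. 4.9.1 (b) p. 55] -/
theorem ncard_rootChildren_null_eq_natCard (hσ : ∀ x, σ (σ x) = x) (hvσ : ∀ a, Valued.v (σ a) = Valued.v a) (hσϖ : σ ϖ = -ϖ)
    (hϖ : Valued.v ϖ = WithZero.exp (-1 : ℤ)) (hres : ∀ x : K, Valued.v x ≤ 1 → Valued.v (σ x - x) < 1) (h2 : Valued.v (2 : K) = 1) [Finite 𝓀[K]]
    (γ : unitaryGroupOfForm σ ((StdForm.antidiagonal 3).over K)) {d : ℕ}
    (Y₀ : Matrix (Fin 3) (Fin 3) 𝒪[K]) (hY₀ : ∀ i j, ((Y₀ i j : 𝒪[K]) : K) = (ϖ ^ d)⁻¹ * ((((γ : GL (Fin 3) K) : Matrix (Fin 3) (Fin 3) K) - 1) i j)) :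
    ({c : {M : Submodule 𝒪[K] (Fin 3 → K) // IsVertex σ ϖ ((StdForm.antidiagonal 3).over K) M} | (latticeGraph σ ϖ ((StdForm.antidiagonal 3).over K)).Adj (⟨stdLattice K 3, 0, isSelfDualLattice_stdLattice_three_of_v hϖ⟩ : {M : Submodule 𝒪[K] (Fin 3 → K) // IsVertex σ ϖ ((StdForm.antidiagonal 3).over K) M}) c ∧ (latticeGraph σ ϖ ((StdForm.antidiagonal 3).over K)).dist ⟨stdLattice K 3, 0, isSelfDualLattice_stdLattice_three_of_v hϖ⟩ c = (latticeGraph σ ϖ ((StdForm.antidiagonal 3).over K)).dist ⟨stdLattice K 3, 0, isSelfDualLattice_stdLattice_three_of_v hϖ⟩ (⟨stdLattice K 3, 0, isSelfDualLattice_stdLattice_three_of_v hϖ⟩ : {M : Submodule 𝒪[K] (Fin 3 → K) // IsVertex σ ϖ ((StdForm.antidiagonal 3).over K) M}) + 1 ∧ ∃ κ : unitaryGroupOfForm σ ((StdForm.antidiagonal 3).over K), κ ∈ unitaryInt σ ((StdForm.antidiagonal 3).over K) ∧ c = latticeGraphIso σ ϖ ((StdForm.antidiagonal 3).over K) κ ⟨latt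 (Matrix.diagonal ![(1 : K), 1, ϖ]), 2, isVertexLattice_two_N₁_of_neg hσϖ hϖ⟩ ∧ Valued.v ((ϖ ^ d)⁻¹ * pairing σ ((StdForm.antidiagonal 3).over K) (((κ : GL (Fin 3) K) : Matrix (Fin 3) (Fin 3) K) *ᵥ Pi.single 0 1) ((((γ : GL (Fin 3) K) : Matrix (Fin 3) (Fin 3) K) - 1) *ᵥ (((κ : GL (Fin 3) K) : Matrix (Fin 3) (Fin 3) K) *ᵥ Pi.single 0 1))) < 1}).ncard =
      Nat.card {p : Option {p : 𝓀[K] × 𝓀[K] // p.2 + (RingHom.id 𝓀[K]) p.2 + p.1 * (RingHom.id 𝓀[K]) p.1 = 0} //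
        ((p.elim (Pi.single 2 1) fun q => ![(1 : 𝓀[K]), q.1.1, q.1.2]) ⬝ᵥ
          ((((StdForm.antidiagonal 3).over 𝓀[K]) * Y₀.map (IsLocalRing.residue 𝒪[K])) *ᵥ (p.elim (Pi.single 2 1) fun q => ![(1 : 𝓀[K]), q.1.1, q.1.2]))) = 0} := by
  have hϖ0 : ϖ ≠ 0 := fun h0 => by rw [h0, map_zero] at hϖ; exact WithZero.coe_ne_zero hϖ.symm
  have hYint : IsIntMatrix (Y₀.map (Valued.integer K).subtype) := fun i j => (Valuation.mem_integer_iff _ _).1 (Y₀ i j).2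
  have hsub : (((γ : GL (Fin 3) K) : Matrix (Fin 3) (Fin 3) K) - 1) = (ϖ ^ d) • Y₀.map (Valued.integer K).subtype := by
    ext i j
    rw [Matrix.smul_apply, Matrix.map_apply, smul_eq_mul]
    change _ = ϖ ^ d * ((Y₀ i j : 𝒪[K]) : K)
    rw [hY₀, mul_inv_cancel_left₀ (pow_ne_zero _ hϖ0)]
  have hset : {c : {M : Submodule 𝒪[K] (Fin 3 → K) // IsVertex σ ϖ ((StdForm.antidiagonal 3).over K) M} | (latticeGraph σ ϖ ((StdForm.antidiagonal 3).over K)).Adj (⟨stdLattice K 3, 0, isSelfDualLattice_stdLattice_three_of_v hϖ⟩ : {M : Submodule 𝒪[K] (Fin 3 → K) // IsVertex σ ϖ ((StdForm.antidiagonal 3).over K) M}) c ∧ (latticeGraph σ ϖ ((StdForm.antidiagonal 3).over K)).dist ⟨stdLattice K 3, 0, isSelfDualLattice_stdLattice_three_of_v hϖ⟩ c = (latticeGraph σ ϖ ((StdForm.antidiagonal 3).over K)).dist ⟨stdLattice K 3, 0, isSelfDualLattice_stdLattice_three_of_v hϖ⟩ (⟨stdLattice K 3, 0, isSelfDualLattice_stdLattice_three_of_v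 hϖ⟩ : {M : Submodule 𝒪[K] (Fin 3 → K) // IsVertex σ ϖ ((StdForm.antidiagonal 3).over K) M}) + 1 ∧ ∃ κ : unitaryGroupOfForm σ ((StdForm.antidiagonal 3).over K), κ ∈ unitaryInt σ ((StdForm.antidiagonal 3).over K) ∧ c = latticeGraphIso σ ϖ ((StdForm.antidiagonal 3).over K) κ ⟨latt (Matrix.diagonal ![(1 : K), 1, ϖ]), 2, isVertexLattice_two_N₁_of_neg hσϖ hϖ⟩ ∧ Valued.v ((ϖ ^ d)⁻¹ * pairing σ ((StdForm.antidiagonal 3).over K) (((κ : GL (Fin 3) K) : Matrix (Fin 3) (Fin 3) K) *ᵥ Pi.single 0 1) ((((γ : GL (Fin 3) K) : Matrix (Fin 3) (Fin 3) K) - 1) *ᵥ (((κ : GL (Fin 3) K) : Matrix (Fin 3) (Fin 3) K) *ᵥ Pi.single 0 1))) < 1} =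
      {w | w ∈ (latticeGraph σ ϖ ((StdForm.antidiagonal 3).over K)).neighborSet ⟨stdLattice K 3, 0, isSelfDualLattice_stdLattice_three_of_v hϖ⟩ ∧
        ∃ κ : unitaryGroupOfForm σ ((StdForm.antidiagonal 3).over K), κ ∈ unitaryInt σ ((StdForm.antidiagonal 3).over K) ∧
          w.1 = mapGL (κ : GL (Fin 3) K) (latt (Matrix.diagonal ![(1 : K), 1, ϖ])) ∧
          ∃ t : 𝒪[K], ((t : K) = (ϖ ^ d)⁻¹ * B₀ σ 3 (((κ : GL (Fin 3) K) : Matrix (Fin 3) (Fin 3) K) *ᵥ (Pi.single 0 1))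
              ((((γ : GL (Fin 3) K) : Matrix (Fin 3) (Fin 3) K) - 1) *ᵥ (((κ : GL (Fin 3) K) : Matrix (Fin 3) (Fin 3) K) *ᵥ (Pi.single 0 1)))) ∧ IsLocalRing.residue 𝒪[K] t = 0} := by
    ext w
    simp only [Set.mem_setOf_eq, SimpleGraph.mem_neighborSet]
    refine and_congr_right fun hadj => ?_
    rw [and_iff_right (by rw [SimpleGraph.dist_self, zero_add]; exact SimpleGraph.dist_eq_one_iff_adj.2 hadj)]
    refine exists_congr fun κ => and_congr_right fun hκ => and_congr ⟨fun h => h ▸ rfl, fun h => Subtype.ext h⟩ ?_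
    obtain ⟨t₀, ht₀⟩ := exists_integer_pairing_mulVec κ hκ hYint
    rw [← pairing_antidiagonal σ, inv_pow_mul_pairing_sub_one_eq hϖ0 hsub]
    exact v_lt_one_iff_exists_residue_eq_zero t₀ ht₀
  rw [hset]
  exact ncard_neighborSet_root_pred_eq_natCard hσ hvσ hσϖ hϖ hres h2 _ Y₀ hY₀ (fun x => x = 0)
    (fun c u hc => by rw [mul_eq_zero, mul_eq_zero, or_self, or_iff_right hc])

set_option maxHeartbeats 800000 in
-- budget only: the child set-builder elaborates once per token.
/-- **THE CLASS-`c` CHILDREN OF THE ROOT = THE CONIC POINTS OF CLASS `χ(c̄₀⁻¹·Q) = 1`.**  Same data, a unit class constant `s = c₀ ∈ 𝒪`: the number of children `c = κ·N₁`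
at distance `1` whose depth-`d` line value lies in the class `s·a²`, `|a| = 1` (the `hνP`∕`hνM` set shape of ★ `rootSlices_hyperbolic_of_lineCounts` with a GENERIC class
constant `s`) equals `#{p : χ(c̄₀⁻¹·ᵗx_p (J₀Ȳ) x_p) = 1}`.  Chain as for the null count, with ★ `exists_unit_class_iff_exists_residue` and ★ G3⁗ at the square-invariant
predicate `P = (χ(c̄₀⁻¹·) = 1)` (★ `quadraticChar_mul_mul_self_mul`). [cite: BruhatTits1972, §10] [cite: Kottwitz1986, §3] [cite: Rogawski1990, §4.9 Prop. 4.9.1 (b) p. 55]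
[cite: IrelandRosen1990, Ch. 8 §1] -/
theorem ncard_rootChildren_class_eq_natCard (hσ : ∀ x, σ (σ x) = x) (hvσ : ∀ a, Valued.v (σ a) = Valued.v a) (hσϖ : σ ϖ = -ϖ)
    (hϖ : Valued.v ϖ = WithZero.exp (-1 : ℤ)) (hres : ∀ x : K, Valued.v x ≤ 1 → Valued.v (σ x - x) < 1) (h2 : Valued.v (2 : K) = 1)
    [Fintype 𝓀[K]] [DecidableEq 𝓀[K]]
    (γ : unitaryGroupOfForm σ ((StdForm.antidiagonal 3).over K)) {d : ℕ}
    (Y₀ : Matrix (Fin 3) (Fin 3) 𝒪[K]) (hY₀ : ∀ i j, ((Y₀ i j : 𝒪[K]) : K) = (ϖ ^ d)⁻¹ * ((((γ : GL (Fin 3) K) : Matrix (Fin 3) (Fin 3) K) - 1) i j))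
    (s : K) (c₀ : 𝒪[K]) (hc₀ : (c₀ : K) = s) (hs : Valued.v s = 1) :
    ({c : {M : Submodule 𝒪[K] (Fin 3 → K) // IsVertex σ ϖ ((StdForm.antidiagonal 3).over K) M} | (latticeGraph σ ϖ ((StdForm.antidiagonal 3).over K)).Adj (⟨stdLattice K 3, 0, isSelfDualLattice_stdLattice_three_of_v hϖ⟩ : {M : Submodule 𝒪[K] (Fin 3 → K) // IsVertex σ ϖ ((StdForm.antidiagonal 3).over K) M}) c ∧ (latticeGraph σ ϖ ((StdForm.antidiagonal 3).over K)).dist ⟨stdLattice K 3, 0, isSelfDualLattice_stdLattice_three_of_v hϖ⟩ c = (latticeGraph σ ϖ ((StdForm.antidiagonal 3).over K)).dist ⟨stdLattice K 3, 0, isSelfDualLattice_stdLattice_three_of_v hϖ⟩ (⟨stdLattice K 3, 0, isSelfDualLattice_stdLattice_three_of_v hϖ⟩ : {M : Submodule 𝒪[K] (Fin 3 → K) // IsVertex σ ϖ ((StdForm.antidiagonal 3).over K) M}) + 1 ∧ ∃ κ : unitaryGroupOfForm σ ((StdForm.antidiagonal 3).over K), κ ∈ unitaryInt σ ((StdForm.antidiagonal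 3).over K) ∧ c = latticeGraphIso σ ϖ ((StdForm.antidiagonal 3).over K) κ ⟨latt (Matrix.diagonal ![(1 : K), 1, ϖ]), 2, isVertexLattice_two_N₁_of_neg hσϖ hϖ⟩ ∧ (∃ a : K, Valued.v a = 1 ∧ Valued.v (((ϖ ^ d)⁻¹ * pairing σ ((StdForm.antidiagonal 3).over K) (((κ : GL (Fin 3) K) : Matrix (Fin 3) (Fin 3) K) *ᵥ Pi.single 0 1) ((((γ : GL (Fin 3) K) : Matrix (Fin 3) (Fin 3) K) - 1) *ᵥ (((κ : GL (Fin 3) K) : Matrix (Fin 3) (Fin 3) K) *ᵥ Pi.single 0 1))) - s * a ^ 2) < 1)}).ncard =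
      Nat.card {p : Option {p : 𝓀[K] × 𝓀[K] // p.2 + (RingHom.id 𝓀[K]) p.2 + p.1 * (RingHom.id 𝓀[K]) p.1 = 0} //
        quadraticChar 𝓀[K] ((IsLocalRing.residue 𝒪[K] c₀)⁻¹ * ((p.elim (Pi.single 2 1) fun q => ![(1 : 𝓀[K]), q.1.1, q.1.2]) ⬝ᵥ
          ((((StdForm.antidiagonal 3).over 𝓀[K]) * Y₀.map (IsLocalRing.residue 𝒪[K])) *ᵥ (p.elim (Pi.single 2 1) fun q => ![(1 : 𝓀[K]), q.1.1, q.1.2])))) = 1} := by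
  have hϖ0 : ϖ ≠ 0 := fun h0 => by rw [h0, map_zero] at hϖ; exact WithZero.coe_ne_zero hϖ.symm
  have hYint : IsIntMatrix (Y₀.map (Valued.integer K).subtype) := fun i j => (Valuation.mem_integer_iff _ _).1 (Y₀ i j).2
  have hsub : (((γ : GL (Fin 3) K) : Matrix (Fin 3) (Fin 3) K) - 1) = (ϖ ^ d) • Y₀.map (Valued.integer K).subtype := by
    ext i j
    rw [Matrix.smul_apply, Matrix.map_apply, smul_eq_mul]
    change _ = ϖ ^ d * ((Y₀ i j : 𝒪[K]) : K)
    rw [hY₀, mul_inv_cancel_left₀ (pow_ne_zero _ hϖ0)]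
  have hset : {c : {M : Submodule 𝒪[K] (Fin 3 → K) // IsVertex σ ϖ ((StdForm.antidiagonal 3).over K) M} | (latticeGraph σ ϖ ((StdForm.antidiagonal 3).over K)).Adj (⟨stdLattice K 3, 0, isSelfDualLattice_stdLattice_three_of_v hϖ⟩ : {M : Submodule 𝒪[K] (Fin 3 → K) // IsVertex σ ϖ ((StdForm.antidiagonal 3).over K) M}) c ∧ (latticeGraph σ ϖ ((StdForm.antidiagonal 3).over K)).dist ⟨stdLattice K 3, 0, isSelfDualLattice_stdLattice_three_of_v hϖ⟩ c = (latticeGraph σ ϖ ((StdForm.antidiagonal 3).over K)).dist ⟨stdLattice K 3, 0, isSelfDualLattice_stdLattice_three_of_v hϖ⟩ (⟨stdLattice K 3, 0, isSelfDualLattice_stdLattice_three_of_v hϖ⟩ : {M : Submodule 𝒪[K] (Fin 3 → K) // IsVertex σ ϖ ((StdForm.antidiagonal 3).over K) M}) + 1 ∧ ∃ κ : unitaryGroupOfForm σ ((StdForm.antidiagonal 3).over K), κ ∈ unitaryInt σ ((StdForm.antidiagonal 3).over K) ∧ c = latticeGraphIso σ ϖ ((StdForm.antidiagonal 3).over K)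 κ ⟨latt (Matrix.diagonal ![(1 : K), 1, ϖ]), 2, isVertexLattice_two_N₁_of_neg hσϖ hϖ⟩ ∧ (∃ a : K, Valued.v a = 1 ∧ Valued.v (((ϖ ^ d)⁻¹ * pairing σ ((StdForm.antidiagonal 3).over K) (((κ : GL (Fin 3) K) : Matrix (Fin 3) (Fin 3) K) *ᵥ Pi.single 0 1) ((((γ : GL (Fin 3) K) : Matrix (Fin 3) (Fin 3) K) - 1) *ᵥ (((κ : GL (Fin 3) K) : Matrix (Fin 3) (Fin 3) K) *ᵥ Pi.single 0 1))) - s * a ^ 2) < 1)} =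
      {w | w ∈ (latticeGraph σ ϖ ((StdForm.antidiagonal 3).over K)).neighborSet ⟨stdLattice K 3, 0, isSelfDualLattice_stdLattice_three_of_v hϖ⟩ ∧
        ∃ κ : unitaryGroupOfForm σ ((StdForm.antidiagonal 3).over K), κ ∈ unitaryInt σ ((StdForm.antidiagonal 3).over K) ∧
          w.1 = mapGL (κ : GL (Fin 3) K) (latt (Matrix.diagonal ![(1 : K), 1, ϖ])) ∧
          ∃ t : 𝒪[K], ((t : K) = (ϖ ^ d)⁻¹ * B₀ σ 3 (((κ : GL (Fin 3) K) : Matrix (Fin 3) (Fin 3) K) *ᵥ (Pi.single 0 1))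
              ((((γ : GL (Fin 3) K) : Matrix (Fin 3) (Fin 3) K) - 1) *ᵥ (((κ : GL (Fin 3) K) : Matrix (Fin 3) (Fin 3) K) *ᵥ (Pi.single 0 1)))) ∧ quadraticChar 𝓀[K] ((IsLocalRing.residue 𝒪[K] c₀)⁻¹ * IsLocalRing.residue 𝒪[K] t) = 1} := by
    ext w
    simp only [Set.mem_setOf_eq, SimpleGraph.mem_neighborSet]
    refine and_congr_right fun hadj => ?_
    rw [and_iff_right (by rw [SimpleGraph.dist_self, zero_add]; exact SimpleGraph.dist_eq_one_iff_adj.2 hadj)]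
    refine exists_congr fun κ => and_congr_right fun hκ => and_congr ⟨fun h => h ▸ rfl, fun h => Subtype.ext h⟩ ?_
    obtain ⟨t₀, ht₀⟩ := exists_integer_pairing_mulVec κ hκ hYint
    rw [← pairing_antidiagonal σ, inv_pow_mul_pairing_sub_one_eq hϖ0 hsub]
    exact exists_unit_class_iff_exists_residue t₀ ht₀ c₀ hc₀ hs
  rw [hset]
  exact ncard_neighborSet_root_pred_eq_natCard hσ hvσ hσϖ hϖ hres h2 _ Y₀ hY₀
    (fun x => quadraticChar 𝓀[K] ((IsLocalRing.residue 𝒪[K] c₀)⁻¹ * x) = 1)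
    (fun e u he => by rw [quadraticChar_mul_mul_self_mul _ he])

set_option maxHeartbeats 800000 in
-- budget only: the child set-builder elaborates once per token.
/-- **THE ENGINE'S `P`-CLASS CHILDREN (`−c₁·a²`) = `#{p : χ((−c̄₀)⁻¹·Q_Ȳ(x_p)) = 1}`** — ★ `rootSlices_hyperbolic_of_lineCounts`'s `hνP` set VERBATIM (`d₀ ↦ d`), `c₁ = c₀` a unit:
the instance `s := −c₁` of `ncard_rootChildren_class_eq_natCard`. [cite: Kottwitz1986, §3] [cite: Rogawski1990, §4.9 Prop. 4.9.1 (b) p. 55] -/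
theorem ncard_rootChildren_negClass_eq_natCard (hσ : ∀ x, σ (σ x) = x) (hvσ : ∀ a, Valued.v (σ a) = Valued.v a) (hσϖ : σ ϖ = -ϖ)
    (hϖ : Valued.v ϖ = WithZero.exp (-1 : ℤ)) (hres : ∀ x : K, Valued.v x ≤ 1 → Valued.v (σ x - x) < 1) (h2 : Valued.v (2 : K) = 1)
    [Fintype 𝓀[K]] [DecidableEq 𝓀[K]]
    (γ : unitaryGroupOfForm σ ((StdForm.antidiagonal 3).over K)) {d : ℕ}
    (Y₀ : Matrix (Fin 3) (Fin 3) 𝒪[K]) (hY₀ : ∀ i j, ((Y₀ i j : 𝒪[K]) : K) = (ϖ ^ d)⁻¹ * ((((γ : GL (Fin 3) K) : Matrix (Fin 3) (Fin 3) K) - 1) i j))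
    (c₁ : K) (c₀ : 𝒪[K]) (hc₀ : (c₀ : K) = c₁) (hc₁ : Valued.v c₁ = 1) :
    ({c : {M : Submodule 𝒪[K] (Fin 3 → K) // IsVertex σ ϖ ((StdForm.antidiagonal 3).over K) M} | (latticeGraph σ ϖ ((StdForm.antidiagonal 3).over K)).Adj (⟨stdLattice K 3, 0, isSelfDualLattice_stdLattice_three_of_v hϖ⟩ : {M : Submodule 𝒪[K] (Fin 3 → K) // IsVertex σ ϖ ((StdForm.antidiagonal 3).over K) M}) c ∧ (latticeGraph σ ϖ ((StdForm.antidiagonal 3).over K)).dist ⟨stdLattice K 3, 0, isSelfDualLattice_stdLattice_three_of_v hϖ⟩ c = (latticeGraph σ ϖ ((StdForm.antidiagonal 3).over K)).dist ⟨stdLattice K 3, 0, isSelfDualLattice_stdLattice_three_of_v hϖ⟩ (⟨stdLattice K 3, 0, isSelfDualLattice_stdLattice_three_of_v hϖ⟩ : {M : Submodule 𝒪[K] (Fin 3 → K) // IsVertex σ ϖ ((StdForm.antidiagonal 3).over K) M}) + 1 ∧ ∃ κ : unitaryGroupOfForm σ ((StdForm.antidiagonal 3).over K), κ ∈ unitaryInt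 σ ((StdForm.antidiagonal 3).over K) ∧ c = latticeGraphIso σ ϖ ((StdForm.antidiagonal 3).over K) κ ⟨latt (Matrix.diagonal ![(1 : K), 1, ϖ]), 2, isVertexLattice_two_N₁_of_neg hσϖ hϖ⟩ ∧ (∃ a : K, Valued.v a = 1 ∧ Valued.v (((ϖ ^ d)⁻¹ * pairing σ ((StdForm.antidiagonal 3).over K) (((κ : GL (Fin 3) K) : Matrix (Fin 3) (Fin 3) K) *ᵥ Pi.single 0 1) ((((γ : GL (Fin 3) K) : Matrix (Fin 3) (Fin 3) K) - 1) *ᵥ (((κ : GL (Fin 3) K) : Matrix (Fin 3) (Fin 3) K) *ᵥ Pi.single 0 1))) - (-c₁) * a ^ 2) < 1)}).ncard =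
      Nat.card {p : Option {p : 𝓀[K] × 𝓀[K] // p.2 + (RingHom.id 𝓀[K]) p.2 + p.1 * (RingHom.id 𝓀[K]) p.1 = 0} //
        quadraticChar 𝓀[K] ((IsLocalRing.residue 𝒪[K] (-c₀))⁻¹ * ((p.elim (Pi.single 2 1) fun q => ![(1 : 𝓀[K]), q.1.1, q.1.2]) ⬝ᵥ
          ((((StdForm.antidiagonal 3).over 𝓀[K]) * Y₀.map (IsLocalRing.residue 𝒪[K])) *ᵥ (p.elim (Pi.single 2 1) fun q => ![(1 : 𝓀[K]), q.1.1, q.1.2])))) = 1} :=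
  ncard_rootChildren_class_eq_natCard hσ hvσ hσϖ hϖ hres h2 γ Y₀ hY₀ (-c₁) (-c₀) (by rw [← hc₀]; push_cast; ring) (by rw [Valuation.map_neg, hc₁])

set_option maxHeartbeats 800000 in
-- budget only: the child set-builder elaborates once per token.
/-- **THE ENGINE'S `M`-CLASS CHILDREN (`−(c₁ε)·a²`, `ε` a non-square unit) = `#{p : χ((−c̄₀)⁻¹·Q_Ȳ(x_p)) = −1}`** — ★ `rootSlices_hyperbolic_of_lineCounts`'s `hνM` set VERBATIM
(`d₀ ↦ d`): the instance `s := −(c₁ε)` of `ncard_rootChildren_class_eq_natCard`, then the key flip of §1 (`χ(ε̄) = −1` from `hε`).  With the null count this exhibits the three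
engine atoms `νE, νP, νM` as the sizes of the three fibres `{Q = 0}, {χ((−c̄₀)⁻¹Q) = 1}, {χ((−c̄₀)⁻¹Q) = −1}` of ONE function on the `q + 1` conic points — the currency of the finite
census heads. [cite: Kottwitz1986, §3] [cite: Rogawski1990, §4.9 Prop. 4.9.1 (b) p. 55] [cite: IrelandRosen1990, Ch. 8 §1] -/
theorem ncard_rootChildren_negClass_mul_eq_natCard (hσ : ∀ x, σ (σ x) = x) (hvσ : ∀ a, Valued.v (σ a) = Valued.v a) (hσϖ : σ ϖ = -ϖ)
    (hϖ : Valued.v ϖ = WithZero.exp (-1 : ℤ)) (hres : ∀ x : K, Valued.v x ≤ 1 → Valued.v (σ x - x) < 1) (h2 : Valued.v (2 : K) = 1)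
    [Fintype 𝓀[K]] [DecidableEq 𝓀[K]]
    (γ : unitaryGroupOfForm σ ((StdForm.antidiagonal 3).over K)) {d : ℕ}
    (Y₀ : Matrix (Fin 3) (Fin 3) 𝒪[K]) (hY₀ : ∀ i j, ((Y₀ i j : 𝒪[K]) : K) = (ϖ ^ d)⁻¹ * ((((γ : GL (Fin 3) K) : Matrix (Fin 3) (Fin 3) K) - 1) i j))
    (c₁ ε : K) (c₀ ε₀ : 𝒪[K]) (hc₀ : (c₀ : K) = c₁) (hε₀ : (ε₀ : K) = ε) (hc₁ : Valued.v c₁ = 1) (hεv : Valued.v ε = 1)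
    (hε : ∀ z : K, Valued.v z ≤ 1 → Valued.v (z ^ 2 - ε) = 1) :
    ({c : {M : Submodule 𝒪[K] (Fin 3 → K) // IsVertex σ ϖ ((StdForm.antidiagonal 3).over K) M} | (latticeGraph σ ϖ ((StdForm.antidiagonal 3).over K)).Adj (⟨stdLattice K 3, 0, isSelfDualLattice_stdLattice_three_of_v hϖ⟩ : {M : Submodule 𝒪[K] (Fin 3 → K) // IsVertex σ ϖ ((StdForm.antidiagonal 3).over K) M}) c ∧ (latticeGraph σ ϖ ((StdForm.antidiagonal 3).over K)).dist ⟨stdLattice K 3, 0, isSelfDualLattice_stdLattice_three_of_v hϖ⟩ c = (latticeGraph σ ϖ ((StdForm.antidiagonal 3).over K)).dist ⟨stdLattice K 3, 0, isSelfDualLattice_stdLattice_three_of_v hϖ⟩ (⟨stdLattice K 3, 0, isSelfDualLattice_stdLattice_three_of_v hϖ⟩ : {M : Submodule 𝒪[K] (Fin 3 → K) // IsVertex σ ϖ ((StdForm.antidiagonal 3).over K) M}) + 1 ∧ ∃ κ : unitaryGroupOfForm σ ((StdForm.antidiagonal 3).over K), κ ∈ unitaryInt σ ((StdForm.antidiagonal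 3).over K) ∧ c = latticeGraphIso σ ϖ ((StdForm.antidiagonal 3).over K) κ ⟨latt (Matrix.diagonal ![(1 : K), 1, ϖ]), 2, isVertexLattice_two_N₁_of_neg hσϖ hϖ⟩ ∧ (∃ a : K, Valued.v a = 1 ∧ Valued.v (((ϖ ^ d)⁻¹ * pairing σ ((StdForm.antidiagonal 3).over K) (((κ : GL (Fin 3) K) : Matrix (Fin 3) (Fin 3) K) *ᵥ Pi.single 0 1) ((((γ : GL (Fin 3) K) : Matrix (Fin 3) (Fin 3) K) - 1) *ᵥ (((κ : GL (Fin 3) K) : Matrix (Fin 3) (Fin 3) K) *ᵥ Pi.single 0 1))) - (-(c₁ * ε)) * a ^ 2) < 1)}).ncard =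
      Nat.card {p : Option {p : 𝓀[K] × 𝓀[K] // p.2 + (RingHom.id 𝓀[K]) p.2 + p.1 * (RingHom.id 𝓀[K]) p.1 = 0} //
        quadraticChar 𝓀[K] ((IsLocalRing.residue 𝒪[K] (-c₀))⁻¹ * ((p.elim (Pi.single 2 1) fun q => ![(1 : 𝓀[K]), q.1.1, q.1.2]) ⬝ᵥ
          ((((StdForm.antidiagonal 3).over 𝓀[K]) * Y₀.map (IsLocalRing.residue 𝒪[K])) *ᵥ (p.elim (Pi.single 2 1) fun q => ![(1 : 𝓀[K]), q.1.1, q.1.2])))) = -1} := by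
  rw [ncard_rootChildren_class_eq_natCard hσ hvσ hσϖ hϖ hres h2 γ Y₀ hY₀ (-(c₁ * ε)) (-c₀ * ε₀) (by rw [← hc₀, ← hε₀]; push_cast; ring)
    (by rw [Valuation.map_neg, Valuation.map_mul, hc₁, hεv, one_mul]), map_mul]
  exact natCard_quadraticChar_inv_mul_eq_one_eq_of_eq_neg_one _ _ (quadraticChar_residue_eq_neg_one_of_forall hε ε₀ hε₀)

end Literature.NumberTheory.Rogawski1990.TypeOneRamifiedJunction
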